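import Mathlib.MeasureTheory.Constructions.HaarToSphere
import Mathlib.Probability.Kernel.Representation
import Mathlib.Probability.Kernel.Composition.MeasureCompProd
import Literature.Analysis.FluidPDE.ControlledHardSphereDynamics
import Literature.Analysis.FluidPDE.HardSphereFlowMeasurable
import Literature.MathematicalPhysics.KineticTheory.ContactLangevinGas
import HarnessLib

/-!
# The stochastic-collision hard-sphere process (the kernel gas `HS(k)`)

Definition item `defn-StochasticCollisionHardSphereProcess` (topic
`Literature/MathematicalPhysics/KineticTheory`), wanted by route `GolfBallGas` of
`AtomisticToContinuum/HydrodynamicLimit` (cruxes `KernelGasEulerLimit`, `ExactCoupling`), by route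
`VanishingNoise` and by the idea cards `angular-noise-ladder` (`HS(p)`) and
`specular-lambertian-swap` (`HS(0)`, the Lambertian gas).

## The model

`N` hard spheres of diameter `ε` in a `Geometry d X` (`𝕋^d` or `ℝ^d`, `HardSpherePhaseSpace.lean`)
move by free flight in the hard-sphere domain; at each incoming binary contact of a pair `(i, j)`
with contact axis `ω = x_i - x_j` (`G.sepVec`, of length `ε`) and relative velocity
`g = v_i - v_j`, `⟪g, ω⟫ < 0`, the pair keeps its centre-of-mass velocity `(v_i + v_j)/2` and its
relative speed `|g|` and leaves with the relative velocity `|g| n'`, the OUTGOING DIRECTION `n'`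
being drawn, independently of the past, from a Markov kernel `k(dn' | ω̂, ĝ)` on the unit sphere
supported in the outgoing hemisphere `{⟪n', ω̂⟫ > 0}`:
`(v_i', v_j') = ((v_i + v_j)/2 + |g| n'/2, (v_i + v_j)/2 - |g| n'/2)`. Pair momentum and kinetic
energy are conserved exactly, whatever `n'` (`redirectVel_fst_add_snd`, `norm_sq_redirectVel`);
`n' = ĝ - 2⟪ĝ, ω̂⟫ω̂` (specular) is the elastic hard-sphere law (`redirectVel_specularDir`,
`redirectPair_specularDir`, `KernelGas.flow_specularSampler`). This is the many-particle,
pair-collision version of the *random billiard* with a Markov (random-reflection) operator at the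
wall (Feres 2007; Comets–Popov–Schütz–Vachkovskaia 2008, §2.2, who drive the billiard by an
i.i.d. sequence exactly as below; Cook–Feres 2012, §1.3 and §2), and belongs to the class of
stochastic hard-sphere dynamics / piecewise-deterministic Markov processes (Rezakhanlou 2003 and
2008, §2, Models I–IV: Markov jump mechanisms for hard-sphere collisions; Davis 1984: deterministic
flow between jumps, jumps at boundary hits). The bulk analogue — momentum- and energy-conserving
velocity-exchange noise acting on nearby (not touching) pairs at an extraneous rate — is the weak
noise of Olla–Varadhan–Yau 1993, §2 (route `VanishingNoise`); it is a different process and is not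
constructed here.

## Contents (namespace `Literature.MathematicalPhysics.KineticTheory`)

* `redirectVel n (v, w)`, `redirectPair i j n z` — the pair rule with prescribed outgoing unit
  direction `n` (positions untouched); conservation of momentum / energy, the outgoing criterion
  `isOutgoing_redirectPair_iff` (`⟪ω, n⟫ > 0`), `specularDir ω g` and the specular case
  `= reflectVel` / `= collidePair`; joint measurability.
* `DirectionSampler d U` — a measurable-dice representation `(ω, g, u) ↦ n'` of a collision kernel
  (the outgoing direction as a deterministic function of the contact data and of a die `u ∈ U`
  thrown afresh at each collision; Kallenberg's Lemma 4.22, Mathlib's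
  `Kernel.exists_measurable_map_eq_unitInterval`, says every Markov kernel on `ℝ^d` has one with
  `U = [0,1]`). `KernelGas.pair/step/stateAfter/instant/count/flow G ε S` — the process driven by a
  die sequence `u₀, u₁, …`: the library's collision-by-collision construction with a noise-driven
  pair rule (`Driven.*` of `ContactLangevinGas.lean`: same free flight `freeFlight`, same exit
  times `Alexander.freeExitTime`, same partner selection `Alexander.incomingPairs` as the
  deterministic flow `Alexander.fwdFlow`), the rule being `redirectPair` along `S ω g uₖ` at the
  `k`-th collision. `KernelGas.dice μ = μ^{⊗ℕ}`, `KernelGas.lawAt` (time-`t` law),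
  `KernelGas.eventLaw` (law of the sequence of post-collisional states and collision instants —
  the object couplings are built on), `KernelGas.pathLaw`.
  Samplers: `specularSampler` (deterministic hard spheres: `KernelGas.flow_specularSampler`),
  `lambertSampler` (the Lambertian redraw `normalize(ω̂ + ξ̂)`, `ξ` Gaussian, of route
  `SpecularLambertianSwap`), `withSpecular p S` (specular with probability `p`, else `S`: the
  interpolation `HS(p)` of card `angular-noise-ladder`).
* `CollisionKernel d = Kernel (ℝ^d × ℝ^d) ℝ^d` — the kernel `k(dn' | ω̂, ĝ)` as a Mathlib Markov
  kernel, fed with the normalised axis and incoming direction; `kernelSampler κ` (a chosen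
  `[0,1]`-sampler realising `κ`, `map_kernelSampler`), `kernelGasFlow κ G ε`, `unitDice`, and
  **`StochasticCollisionHardSphereProcess κ G ε N t : Config N d X × (ℕ → [0,1]) → Config N d X`**
  — the kernel gas `HS(k)` as a random variable on the canonical sample space
  `(initial datum) × (dice)`; under `P₀ ⊗ unitDice` it is the gas started from the law `P₀`.
  `kernelGasLawAt κ G ε N P₀ t : Measure (Config N d X)` (push-forward of `P₀ ⊗ unitDice` by the
  time-`t` map), `kernelGasEventLaw`, `kernelGasPathLaw`.
* Flux measures and the predicates on `k`: `unitSphereMeasure d` (surface measure of `S^{d-1}` as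
  a measure on `ℝ^d`, Mathlib's `Measure.toSphere`), the incoming / outgoing flux (Knudsen cosine)
  measures `fluxIn ω = (-⟪g, ω⟫)₊ dσ(g)`, `fluxOut ω = (⟪n, ω⟫)₊ dσ(n)`, the pair flux
  `pairFlux κ ω = fluxIn ω ⊗ k(· | ω, g)`; `IsOutgoingSupported κ`; `IsFluxStationary κ` (the cosine
  law is mapped to the cosine law: Cook–Feres 2012 Thm. 1 / Prop. 8, Comets et al. 2008 Thm. 2.4 —
  what makes Liouville ⊗ Maxwellians invariant); `IsFluxReciprocal κ` (time-reversal symmetry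
  `P* = JPJ` of Cook–Feres 2012 Prop. 3 in intrinsic variables: `fluxIn(dĝ) k(dn' | ĝ)` is
  invariant under `(ĝ, n') ↦ (-n', -ĝ)`, i.e. detailed balance of the collision mechanism with
  respect to the flux measure ⊗ Maxwellian); `IsIsotropic κ` (frame independence).
  `specularKernel` (`δ_{specular}`).
* Measurability: for a regular measurable geometry and a jointly measurable sampler the time-`t`
  map `(z, u) ↦ KernelGas.flow G ε S u z t` is measurable (`KernelGas.measurable_flow`,
  `measurable_stochasticCollisionHardSphereProcess`), so the laws above are genuine push-forwards.

## Design choices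

* RANDOMNESS BY DICE. A Markov kernel depending on the current contact data cannot be driven by a
  product measure directly; we use the standard stochastic-recursion representation
  `n'ₖ = S(ωₖ, gₖ, uₖ)` with i.i.d. dice `uₖ` (Comets et al. 2008 §2.2 (i)–(ii) do exactly this
  for the random billiard; Kallenberg Lemma 4.22 for general kernels), so that the whole process
  is a deterministic, collision-by-collision function of `(z₀, (uₖ))` — literally the library's
  `Driven` recursion — and every law is a push-forward of `P₀ ⊗ μ^{⊗ℕ}`. For a `CollisionKernel`
  the sampler is CHOSEN (`Classical.choose`); laws do not depend on the choice, pathwise objects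
  do, and statements should be about laws (or quantify over samplers with `map_sampler`-type
  hypotheses, as `SpecularLambertianSwap` does with its explicit Gaussian sampler).
* The kernel is fed `(‖ω‖⁻¹ω, ‖g‖⁻¹g)`: `k(dn' | ω̂, ĝ)` depends on directions only, as requested;
  `|g|` is restored by `redirectVel`. Values of a kernel off unit inputs, and of the process off
  the good set (multiple / grazing contacts, accumulation of collision instants), are junk, as for
  `Alexander.fwdFlow`; well-posedness (a.s. finitely many simple collisions from absolutely
  continuous data) and invariance of Liouville ⊗ Maxwell / Gibbs laws under flux-stationary
  kernels are STATEMENTS for the routes (cf. `LambertianWellPosed` of `SpecularLambertianSwap`),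
  deliberately not named facts here (they are not printed theorems for this `N`-body process).
* Forward time only (`t ≥ 0`), right-continuous paths, as `Driven.flow` / `Alexander.fwdFlow`.
* General `Geometry d X` and dimension; the torus at fixed reduced density is the instance
  `G = Torus.geometry (Fin 3)`, `ε = hsDiameter σ N`, `N + 1` spheres (`HardSphereEuler.lean`).

## References

* R. Feres, *Random walks derived from billiards*, in: Dynamics, Ergodic Theory and Geometry,
  MSRI Publ. 54 (2007) 179–222 (random billiards with a Markov reflection operator).
* F. Comets, S. Popov, G. M. Schütz, M. Vachkovskaia, *Billiards in a general domain with random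
  reflections*, Arch. Ration. Mech. Anal. 191 (2008) 497–537, §2.2 (construction from an i.i.d.
  sequence), §2.3 (cosine law `γ̄ = γ_d ⟪e, ·⟫`), Thm. 2.4 (invariance of uniform ⊗ uniform for
  the Knudsen billiard), Thm. 2.5 (reversibility up to the velocity flip).
* S. Cook, R. Feres, *Random billiards with wall temperature and associated Markov chains*,
  Nonlinearity 25 (2012) 2503–2541, §1.3 (the Markov operator `P`), Thm. 1 and Prop. 8 (Knudsen
  cosine law stationary), §2.2 Prop. 3 (`P* = JPJ`, time reversibility), Prop. 4 (detailed balance).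
* F. Rezakhanlou, *A stochastic model associated with Enskog equation and its kinetic limit*,
  Comm. Math. Phys. 232 (2003) 327–375; F. Rezakhanlou, in: *Entropy Methods for the Boltzmann
  Equation*, LNM 1916 (2008), §2, Models I–IV (stochastic hard-sphere collision mechanisms).
* M. H. A. Davis, *Piecewise-deterministic Markov processes*, J. R. Stat. Soc. B 46 (1984) 353–376.
* S. Olla, S. R. S. Varadhan, H.-T. Yau, Comm. Math. Phys. 155 (1993) 523–560, §2 (the bulk
  conservative noise).
* C. Cercignani, R. Illner, M. Pulvirenti, *The Mathematical Theory of Dilute Gases* (1994), App.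
  4.A (collision-by-collision construction); I. Gallagher, L. Saint-Raymond, B. Texier, *From
  Newton to Boltzmann* (2013), (1.1.2)–(1.1.3) (the elastic law).
* O. Kallenberg, *Foundations of Modern Probability* (2021), Lemma 4.22 (kernel representation).
-/

noncomputable section

open MeasureTheory ProbabilityTheory Function Set unitInterval
open Literature.Analysis.FluidPDE
open scoped ENNReal InnerProductSpace

namespace Literature.MathematicalPhysics.KineticTheory

/-! ### The pair rule: keep the centre of mass, redirect the relative velocity -/

section Redirect

variable {E : Type*} [NormedAddCommGroup E] [InnerProductSpace ℝ E]

/-- The **redirected pair**: from pair velocities `p = (v, w)` and a (unit, outgoing) direction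
`n`, keep the centre-of-mass velocity `c = (v + w)/2` and the relative speed `|g|`, `g = v - w`, and
leave with relative velocity `|g| n`: `(v', w') = (c + |g| n/2, c - |g| n/2)` — the post-collisional
velocities of a binary collision of equal masses with outgoing relative direction `n`
(GST 2013 (1.1.2)–(1.1.3) is the case `n = ĝ - 2⟪ĝ, ω̂⟫ω̂`, `redirectVel_specularDir`; the general
`n` is the random-reflection rule of a random billiard applied to the relative velocity, Comets et
al. 2008 §2.2, Cook–Feres 2012 §1.3). [cite: GST2013, (1.1.2)] -/
def redirectVel (n : E) (p : E × E) : E × E :=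
  ((2 : ℝ)⁻¹ • (p.1 + p.2) + (‖p.1 - p.2‖ / 2) • n,
    (2 : ℝ)⁻¹ • (p.1 + p.2) - (‖p.1 - p.2‖ / 2) • n)

/-- Conservation of momentum: `v' + w' = v + w`. [cite: GST2013, §1.1] -/
theorem redirectVel_fst_add_snd (n : E) (p : E × E) :
    (redirectVel n p).1 + (redirectVel n p).2 = p.1 + p.2 := by
  simp only [redirectVel]
  module

/-- The new relative velocity is `|g| n`. [folklore] -/
theorem redirectVel_fst_sub_snd (n : E) (p : E × E) :
    (redirectVel n p).1 - (redirectVel n p).2 = ‖p.1 - p.2‖ • n := by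
  simp only [redirectVel]
  module

/-- The normal component of the new relative velocity: `⟪ω, v' - w'⟫ = |g| ⟪ω, n⟫`. [folklore] -/
theorem inner_redirectVel_fst_sub_snd (ω n : E) (p : E × E) :
    ⟪ω, (redirectVel n p).1 - (redirectVel n p).2⟫_ℝ = ‖p.1 - p.2‖ * ⟪ω, n⟫_ℝ := by
  rw [redirectVel_fst_sub_snd, real_inner_smul_right]

/-- Conservation of kinetic energy, `|v'|² + |w'|² = |v|² + |w|²`, for a UNIT outgoing direction
(parallelogram law and `|g'| = |g|`). [cite: GST2013, §1.1] -/
theorem norm_sq_redirectVel {n : E} (hn : ‖n‖ = 1) (p : E × E) :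
    ‖(redirectVel n p).1‖ ^ 2 + ‖(redirectVel n p).2‖ ^ 2 = ‖p.1‖ ^ 2 + ‖p.2‖ ^ 2 := by
  have key : ∀ c y : E, ‖c + y‖ ^ 2 + ‖c - y‖ ^ 2 = 2 * ‖c‖ ^ 2 + 2 * ‖y‖ ^ 2 := by
    intro c y
    rw [norm_add_sq_real, norm_sub_sq_real]
    ring
  have hy : ‖(‖p.1 - p.2‖ / 2) • n‖ ^ 2 = ‖(2 : ℝ)⁻¹ • (p.1 - p.2)‖ ^ 2 := by
    rw [norm_smul, norm_smul, hn, mul_one, Real.norm_eq_abs, Real.norm_eq_abs,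
      abs_of_nonneg (by positivity), abs_of_pos (by norm_num : (0 : ℝ) < 2⁻¹)]
    ring
  have h1 : p.1 = (2 : ℝ)⁻¹ • (p.1 + p.2) + (2 : ℝ)⁻¹ • (p.1 - p.2) := by module
  have h2 : p.2 = (2 : ℝ)⁻¹ • (p.1 + p.2) - (2 : ℝ)⁻¹ • (p.1 - p.2) := by module
  calc ‖(redirectVel n p).1‖ ^ 2 + ‖(redirectVel n p).2‖ ^ 2
      = 2 * ‖(2 : ℝ)⁻¹ • (p.1 + p.2)‖ ^ 2 + 2 * ‖(‖p.1 - p.2‖ / 2) • n‖ ^ 2 := key _ _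
    _ = 2 * ‖(2 : ℝ)⁻¹ • (p.1 + p.2)‖ ^ 2 + 2 * ‖(2 : ℝ)⁻¹ • (p.1 - p.2)‖ ^ 2 := by rw [hy]
    _ = ‖(2 : ℝ)⁻¹ • (p.1 + p.2) + (2 : ℝ)⁻¹ • (p.1 - p.2)‖ ^ 2 +
          ‖(2 : ℝ)⁻¹ • (p.1 + p.2) - (2 : ℝ)⁻¹ • (p.1 - p.2)‖ ^ 2 := (key _ _).symm
    _ = ‖p.1‖ ^ 2 + ‖p.2‖ ^ 2 := by rw [← h1, ← h2]

/-- Redirecting along `n` after flipping both velocities is flipping after redirecting along `-n`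
(the identity behind time reversal of the kernel gas). [folklore] -/
theorem redirectVel_neg_neg (n v w : E) :
    redirectVel n (-v, -w) = (-(redirectVel (-n) (v, w)).1, -(redirectVel (-n) (v, w)).2) := by
  have h : ‖-v - -w‖ = ‖v - w‖ := by rw [← norm_neg]; congr 1; abel
  simp only [redirectVel, h, smul_neg, Prod.mk.injEq]
  constructor <;> module

/-- The **specular outgoing direction** at contact axis `ω` for incoming relative velocity `g`:
the unit vector of the reflected relative velocity `g - 2 (⟪g, ω⟫/|ω|²) ω` (GST 2013 (1.1.3);
junk `0` for `g = 0`). [cite: GST2013, (1.1.3)] -/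
def specularDir (ω g : E) : E := ‖g‖⁻¹ • (g - (2 * (⟪g, ω⟫_ℝ / ‖ω‖ ^ 2)) • ω)

/-- The reflection across `ω^⊥` is an isometry: `|g - 2 (⟪g, ω⟫/|ω|²) ω| = |g|`. [folklore] -/
theorem norm_sub_two_mul_smul (ω g : E) : ‖g - (2 * (⟪g, ω⟫_ℝ / ‖ω‖ ^ 2)) • ω‖ = ‖g‖ := by
  by_cases hω : ω = 0
  · simp [hω]
  have hω' : ‖ω‖ ≠ 0 := norm_ne_zero_iff.2 hω
  have h : ‖g - (2 * (⟪g, ω⟫_ℝ / ‖ω‖ ^ 2)) • ω‖ ^ 2 = ‖g‖ ^ 2 := by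
    rw [norm_sub_sq_real, real_inner_smul_right, norm_smul, Real.norm_eq_abs, mul_pow, sq_abs,
      real_inner_comm ω g]
    field_simp
    ring
  have h' := congrArg Real.sqrt h
  rwa [Real.sqrt_sq (norm_nonneg _), Real.sqrt_sq (norm_nonneg _)] at h'

/-- The specular direction is a unit vector (for `g ≠ 0`). [folklore] -/
theorem norm_specularDir (ω : E) {g : E} (hg : g ≠ 0) : ‖specularDir ω g‖ = 1 := by
  rw [specularDir, norm_smul, norm_inv, norm_norm, norm_sub_two_mul_smul,
    inv_mul_cancel₀ (norm_ne_zero_iff.2 hg)]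

/-- The specular direction is outgoing when `g` is incoming: `⟪ω, specularDir ω g⟫ = -⟪ω, g⟫/|g|`
(`ω ≠ 0`). [folklore] -/
theorem inner_specularDir (ω g : E) (hω : ω ≠ 0) :
    ⟪ω, specularDir ω g⟫_ℝ = -(⟪ω, g⟫_ℝ / ‖g‖) := by
  have hω' : ‖ω‖ ^ 2 ≠ 0 := pow_ne_zero 2 (norm_ne_zero_iff.2 hω)
  rw [specularDir, real_inner_smul_right, inner_sub_right, real_inner_smul_right,
    real_inner_self_eq_norm_sq, real_inner_comm ω g]
  field_simp
  ring

/-- **SPECULAR CASE**: redirecting along the specular direction of the current relative velocity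
IS the elastic reflection law `reflectVel` of the library (GST 2013 (1.1.2)–(1.1.3)); no
hypothesis (both sides are the identity when `v = w`). [cite: GST2013, (1.1.2)] -/
theorem redirectVel_specularDir (ω v w : E) :
    redirectVel (specularDir ω (v - w)) (v, w) = reflectVel ω (v, w) := by
  rcases eq_or_ne (v - w) 0 with hg | hg
  · have hvw : v = w := sub_eq_zero.1 hg
    subst hvw
    have h2 : (2 : ℝ)⁻¹ • (v + v) = v := by module
    simp [redirectVel, reflectVel, h2]
  · have hn : ‖v - w‖ ≠ 0 := norm_ne_zero_iff.2 hg
    have hc : ‖v - w‖ / 2 * ‖v - w‖⁻¹ = 2⁻¹ := by field_simp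
    simp only [redirectVel, specularDir, reflectVel, smul_smul, hc, Prod.mk.injEq]
    constructor <;> module

end Redirect

/-! ### The pair rule on configurations -/

section Pair

variable {d : Type*} [Fintype d] {X : Type*} {N : ℕ}

/-- **Redirected collision of the pair `(i, j)` along `n`** in the configuration `z`: positions
unchanged, `(v_i, v_j) ↦ redirectVel n (v_i, v_j)` — centre of mass kept, relative velocity set to
`|v_i - v_j| n` —, all other particles unchanged (`collidePair` is the case
`n = specularDir (x_i - x_j) (v_i - v_j)`, `redirectPair_specularDir`). [folklore] -/
def redirectPair (i j : Fin N) (n : EuclideanSpace ℝ d) (z : Config N d X) : Config N d X :=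
  Function.update (Function.update z i ((z i).1, (redirectVel n ((z i).2, (z j).2)).1)) j
    ((z j).1, (redirectVel n ((z i).2, (z j).2)).2)

variable {i j : Fin N}

/-- After the redirected collision, particle `i`. [folklore] -/
theorem redirectPair_apply_left (hij : i ≠ j) (n : EuclideanSpace ℝ d) (z : Config N d X) :
    redirectPair i j n z i = ((z i).1, (redirectVel n ((z i).2, (z j).2)).1) := by
  simp [redirectPair, Function.update_of_ne hij]

/-- After the redirected collision, particle `j`. [folklore] -/
theorem redirectPair_apply_right (n : EuclideanSpace ℝ d) (z : Config N d X) :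
    redirectPair i j n z j = ((z j).1, (redirectVel n ((z i).2, (z j).2)).2) := by
  simp [redirectPair]

/-- Particles other than `i, j` are unaffected. [folklore] -/
theorem redirectPair_apply_of_ne {k : Fin N} (hki : k ≠ i) (hkj : k ≠ j) (n : EuclideanSpace ℝ d)
    (z : Config N d X) : redirectPair i j n z k = z k := by
  simp [redirectPair, Function.update_of_ne hki, Function.update_of_ne hkj]

/-- A redirected collision does not move the particles. [folklore] -/
@[simp]
theorem redirectPair_apply_fst (n : EuclideanSpace ℝ d) (z : Config N d X) (k : Fin N) :
    (redirectPair i j n z k).1 = (z k).1 := by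
  by_cases hkj : k = j
  · subst hkj; rw [redirectPair_apply_right]
  by_cases hki : k = i
  · subst hki; rw [redirectPair_apply_left hkj]
  rw [redirectPair_apply_of_ne hki hkj]

/-- Redirected collisions preserve the hard-sphere domain (positions do not move). [folklore] -/
theorem redirectPair_mem_hardSphereDomain_iff {G : Geometry d X} {ε : ℝ} (n : EuclideanSpace ℝ d)
    (z : Config N d X) :
    redirectPair i j n z ∈ hardSphereDomain G N ε ↔ z ∈ hardSphereDomain G N ε := by
  simp [mem_hardSphereDomain]

/-- **Momentum is conserved** by every redirected collision. [cite: GST2013, §1.1] -/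
theorem configMomentum_redirectPair (hij : i ≠ j) (n : EuclideanSpace ℝ d) (z : Config N d X) :
    configMomentum (redirectPair i j n z) = configMomentum z := by
  unfold configMomentum
  refine sum_eq_sum_of_pair' hij ?_ fun k hki hkj => by rw [redirectPair_apply_of_ne hki hkj]
  rw [redirectPair_apply_left hij, redirectPair_apply_right]
  exact redirectVel_fst_add_snd _ _

/-- **Kinetic energy is conserved** by every redirected collision along a unit direction.
[cite: GST2013, §1.1] -/
theorem configEnergy_redirectPair (hij : i ≠ j) {n : EuclideanSpace ℝ d} (hn : ‖n‖ = 1)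
    (z : Config N d X) : configEnergy (redirectPair i j n z) = configEnergy z := by
  unfold configEnergy
  congr 1
  refine sum_eq_sum_of_pair' hij ?_ fun k hki hkj => by rw [redirectPair_apply_of_ne hki hkj]
  rw [redirectPair_apply_left hij, redirectPair_apply_right]
  exact norm_sq_redirectVel hn _

/-- **The pair separates iff the drawn direction points into the outgoing hemisphere**:
`IsOutgoing G (redirectPair i j n z) i j ↔ 0 < ⟪x_i - x_j, n⟫` (for `v_i ≠ v_j`). [folklore] -/
theorem isOutgoing_redirectPair_iff {G : Geometry d X} (hij : i ≠ j) {z : Config N d X}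
    (hg : (z i).2 ≠ (z j).2) (n : EuclideanSpace ℝ d) :
    IsOutgoing G (redirectPair i j n z) i j ↔ 0 < ⟪G.sepVec (z i).1 (z j).1, n⟫_ℝ := by
  unfold IsOutgoing
  rw [redirectPair_apply_fst, redirectPair_apply_fst, redirectPair_apply_left hij,
    redirectPair_apply_right, inner_redirectVel_fst_sub_snd]
  exact mul_pos_iff_of_pos_left (norm_pos_iff.2 (sub_ne_zero.2 hg))

/-- **SPECULAR CASE**: redirecting along the specular direction of the contact axis is the
elastic collision `collidePair` of the library. [cite: GST2013, (1.1.2)] -/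
theorem redirectPair_specularDir (G : Geometry d X) (i j : Fin N) (z : Config N d X) :
    redirectPair i j (specularDir (G.sepVec (z i).1 (z j).1) ((z i).2 - (z j).2)) z =
      collidePair G i j z := by
  simp only [redirectPair, collidePair, redirectVel_specularDir]

/-- Flipping all velocities commutes with the pair rule up to `n ↦ -n` (time reversal).
[folklore] -/
theorem redirectPair_flipVel (hij : i ≠ j) (n : EuclideanSpace ℝ d) (z : Config N d X) :
    redirectPair i j n (flipVel z) = flipVel (redirectPair i j (-n) z) := by
  funext k
  by_cases hkj : k = j
  · subst hkj
    rw [flipVel_apply, redirectPair_apply_right, flipVel_apply, flipVel_apply, redirectVel_neg_neg,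
      redirectPair_apply_right]
  by_cases hki : k = i
  · subst hki
    rw [flipVel_apply, redirectPair_apply_left hkj, flipVel_apply, flipVel_apply,
      redirectVel_neg_neg, redirectPair_apply_left hkj]
  simp only [flipVel_apply, redirectPair_apply_of_ne hki hkj]

/-- Joint measurability of the pair rule in (configuration, direction). [folklore] -/
theorem measurable_redirectPair [MeasurableSpace X] (i j : Fin N) :
    Measurable fun q : Config N d X × EuclideanSpace ℝ d => redirectPair i j q.2 q.1 := by
  have hvi : Measurable fun q : Config N d X × EuclideanSpace ℝ d => (q.1 i).2 :=
    (Geometry.IsMeasurable.measurable_vel i).comp measurable_fst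
  have hvj : Measurable fun q : Config N d X × EuclideanSpace ℝ d => (q.1 j).2 :=
    (Geometry.IsMeasurable.measurable_vel j).comp measurable_fst
  have hc : Measurable fun q : Config N d X × EuclideanSpace ℝ d =>
      (2 : ℝ)⁻¹ • ((q.1 i).2 + (q.1 j).2) := (hvi.add hvj).const_smul ((2 : ℝ)⁻¹)
  have hw : Measurable fun q : Config N d X × EuclideanSpace ℝ d =>
      (‖(q.1 i).2 - (q.1 j).2‖ / 2) • q.2 := ((hvi.sub hvj).norm.div_const 2).smul measurable_snd
  refine measurable_pi_lambda _ fun k => ?_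
  by_cases hkj : k = j
  · subst hkj
    simp only [redirectPair_apply_right]
    exact ((Geometry.IsMeasurable.measurable_pos k).comp measurable_fst).prodMk (hc.sub hw)
  by_cases hki : k = i
  · subst hki
    simp only [redirectPair_apply_left hkj]
    exact ((Geometry.IsMeasurable.measurable_pos k).comp measurable_fst).prodMk (hc.add hw)
  · simp only [redirectPair_apply_of_ne hki hkj]
    exact (measurable_pi_apply k).comp measurable_fst

end Pair

/-! ### Direction samplers and the kernel gas driven by dice -/

/-- A **direction sampler** with dice space `U`: to a contact axis `ω` (pointing from `j` to `i`),
an incoming relative velocity `g` and a die value `u` it assigns the outgoing unit direction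
`n' = S ω g u`. With `u` distributed by a probability `μ` on `U` this REPRESENTS the collision
kernel `k(dn' | ω, g) = (S ω g)_* μ` (Comets et al. 2008 §2.2: the random reflection realised as a
fixed density `γ̄` on a reference hemisphere, an i.i.d. sequence `ηₙ ~ γ̄` and rotations `U_x`;
Kallenberg Lemma 4.22: every Markov kernel on a standard Borel space is of this form with
`U = [0,1]`, `kernelSampler`). [cite: CometsEtAl2008, §2.2] -/
abbrev DirectionSampler (d : Type*) [Fintype d] (U : Type*) : Type _ :=
  EuclideanSpace ℝ d → EuclideanSpace ℝ d → U → EuclideanSpace ℝ d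

namespace KernelGas

variable {d : Type*} [Fintype d] {X : Type*} {N : ℕ} {U : Type*}

/-- The kernel-gas pair rule: redirect the pair `(i, j)` of `z` along the sampled direction
`S (x_i - x_j) (v_i - v_j) u` (contact axis `G.sepVec`, minimal image on the torus). [folklore] -/
def pair (G : Geometry d X) (S : DirectionSampler d U) (i j : Fin N) (z : Config N d X) (u : U) :
    Config N d X :=
  redirectPair i j (S (G.sepVec (z i).1 (z j).1) ((z i).2 - (z j).2) u) z

/-- One step of the kernel gas: free flight to the exit time `Alexander.freeExitTime`, then the
redirected collision of the incoming contact pair along the direction sampled with the die `u`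
(the library's `Driven.step` with rule `pair G S`; CIP 1994 App. 4.A with the reflection replaced
by the random redraw). [cite: CIP1994, App. 4.A p. 111] -/
abbrev step (G : Geometry d X) (ε : ℝ) (S : DirectionSampler d U) :
    U → Config N d X → Config N d X :=
  Driven.step G ε (pair G S)

/-- The `k`-th post-collisional state `z_k` of the kernel gas driven by the dice `us`
(`z_{k+1} = step (us k) z_k`). [cite: CIP1994, App. 4.A p. 109] -/
abbrev stateAfter (G : Geometry d X) (ε : ℝ) (S : DirectionSampler d U) :
    (ℕ → U) → Config N d X → ℕ → Config N d X :=
  Driven.stateAfter G ε (pair G S)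

/-- The `k`-th collision instant `t_k = ∑_{m<k} τ(z_m) ∈ [0, ∞]` of the kernel gas.
[cite: CIP1994, App. 4.A p. 109] -/
abbrev instant (G : Geometry d X) (ε : ℝ) (S : DirectionSampler d U) :
    (ℕ → U) → Config N d X → ℕ → ℝ≥0∞ :=
  Driven.instant G ε (pair G S)

/-- The number of collisions of the kernel gas in `[0, t]`. [folklore] -/
abbrev count (G : Geometry d X) (ε : ℝ) (S : DirectionSampler d U) :
    (ℕ → U) → Config N d X → ℝ → ℕ :=
  Driven.count G ε (pair G S)

/-- **The kernel gas path** `t ↦ Λ_t(z; us)`: free flight from the last post-collisional state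
(right-continuous, forward in time; the library's `Driven.flow` with rule `pair G S`).
[cite: CIP1994, §4.2 p. 65] -/
abbrev flow (G : Geometry d X) (ε : ℝ) (S : DirectionSampler d U) :
    (ℕ → U) → Config N d X → ℝ → Config N d X :=
  Driven.flow G ε (pair G S)

/-- The law of the dice sequence: i.i.d. with law `μ`, one die per collision
(`Measure.infinitePi`). [folklore] -/
def dice [MeasurableSpace U] (μ : Measure U) [IsProbabilityMeasure μ] : Measure (ℕ → U) :=
  Measure.infinitePi fun _ : ℕ => μ

/-- The dice law is a probability measure. [folklore] -/
instance [MeasurableSpace U] (μ : Measure U) [IsProbabilityMeasure μ] :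
    IsProbabilityMeasure (dice μ) := by
  unfold dice; infer_instance

section Laws

variable [MeasurableSpace X] [MeasurableSpace U]

/-- **The time-`t` law** of the kernel gas with sampler `S`, dice law `μ` and initial law `P₀`:
the push-forward of `P₀ ⊗ μ^{⊗ℕ}` by `(z, us) ↦ Λ_t(z; us)` (a genuine push-forward when the
time-`t` map is measurable, `KernelGas.measurable_flow`; Mathlib's `Measure.map` is `0` otherwise).
[folklore] -/
def lawAt (G : Geometry d X) (ε : ℝ) (S : DirectionSampler d U) (μ : Measure U)
    [IsProbabilityMeasure μ] (P₀ : Measure (Config N d X)) (t : ℝ) : Measure (Config N d X) :=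
  (P₀.prod (dice μ)).map fun q => flow G ε S q.2 q.1 t

/-- **The law of the collision sequence** `(z_k, t_k)_{k ∈ ℕ}` (post-collisional states and
collision instants) of the kernel gas started from `P₀` — the skeleton chain of the
piecewise-deterministic process (Davis 1984), on which couplings of two gases "with the same
collisions" are formulated. [cite: Davis1984, §2] -/
def eventLaw (G : Geometry d X) (ε : ℝ) (S : DirectionSampler d U) (μ : Measure U)
    [IsProbabilityMeasure μ] (P₀ : Measure (Config N d X)) :
    Measure (ℕ → Config N d X × ℝ≥0∞) :=
  (P₀.prod (dice μ)).map fun q k => (stateAfter G ε S q.2 q.1 k, instant G ε S q.2 q.1 k)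

/-- **The path-space law** of the kernel gas started from `P₀` (product σ-algebra on
`ℝ → Config N d X`). [folklore] -/
def pathLaw (G : Geometry d X) (ε : ℝ) (S : DirectionSampler d U) (μ : Measure U)
    [IsProbabilityMeasure μ] (P₀ : Measure (Config N d X)) : Measure (ℝ → Config N d X) :=
  (P₀.prod (dice μ)).map fun q t => flow G ε S q.2 q.1 t

end Laws

/-! #### Elementary API -/

variable {G : Geometry d X} {ε : ℝ} {S : DirectionSampler d U}

/-- The kernel-gas rule does not move particles. [folklore] -/
@[simp]
theorem pair_apply_fst (i j : Fin N) (z : Config N d X) (u : U) (k : Fin N) :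
    (pair G S i j z u k).1 = (z k).1 :=
  redirectPair_apply_fst _ z k

/-- The kernel-gas rule conserves momentum. [cite: GST2013, §1.1] -/
theorem configMomentum_pair {i j : Fin N} (hij : i ≠ j) (z : Config N d X) (u : U) :
    configMomentum (pair G S i j z u) = configMomentum z :=
  configMomentum_redirectPair hij _ z

/-- The kernel-gas rule conserves kinetic energy as soon as the sampled direction is a unit
vector. [cite: GST2013, §1.1] -/
theorem configEnergy_pair {i j : Fin N} (hij : i ≠ j) (z : Config N d X) (u : U)
    (hS : ‖S (G.sepVec (z i).1 (z j).1) ((z i).2 - (z j).2) u‖ = 1) :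
    configEnergy (pair G S i j z u) = configEnergy z :=
  configEnergy_redirectPair hij hS z

/-- An incoming pair leaves the kernel-gas collision outgoing iff the sampled direction lies in
the open outgoing hemisphere `⟪x_i - x_j, n'⟫ > 0`. [folklore] -/
theorem isOutgoing_pair_iff {i j : Fin N} (hij : i ≠ j) {z : Config N d X}
    (hg : (z i).2 ≠ (z j).2) (u : U) :
    IsOutgoing G (pair G S i j z u) i j ↔
      0 < ⟪G.sepVec (z i).1 (z j).1, S (G.sepVec (z i).1 (z j).1) ((z i).2 - (z j).2) u⟫_ℝ :=
  isOutgoing_redirectPair_iff hij hg _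

/-- One step conserves momentum (whatever happens: no collision, or a genuine pair collides).
[cite: GST2013, §1.1] -/
theorem configMomentum_step (u : U) (z : Config N d X) :
    configMomentum (step G ε S u z) = configMomentum z := by
  unfold step Driven.step
  dsimp only
  split_ifs with h₁ h₂
  · rfl
  · rw [configMomentum_pair (ne_of_lt (Alexander.mem_incomingPairs.1 h₂.some_mem).1)]
    exact configMomentum_freeFlight _ _ _
  · exact configMomentum_freeFlight _ _ _

/-- Along the collision sequence momentum is conserved. [cite: GST2013, §1.1] -/
theorem configMomentum_stateAfter (us : ℕ → U) (z : Config N d X) (k : ℕ) :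
    configMomentum (stateAfter G ε S us z k) = configMomentum z := by
  induction k with
  | zero => rfl
  | succ k ih =>
    rw [show stateAfter G ε S us z (k + 1) = step G ε S (us k) (stateAfter G ε S us z k) from rfl,
      configMomentum_step, ih]

/-- The kernel gas conserves the total momentum pathwise. [cite: GST2013, §1.1] -/
theorem configMomentum_flow (us : ℕ → U) (z : Config N d X) (t : ℝ) :
    configMomentum (flow G ε S us z t) = configMomentum z := by
  unfold flow Driven.flow
  rw [configMomentum_freeFlight, configMomentum_stateAfter]

/-- A sampler is **unit-valued on collisions** if it returns unit vectors for nonzero axis and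
relative velocity (the only inputs met along the dynamics). [folklore] -/
def IsUnit (S : DirectionSampler d U) : Prop :=
  ∀ ω g u, ω ≠ 0 → g ≠ 0 → ‖S ω g u‖ = 1

/-- One step conserves kinetic energy for a unit-valued sampler (`ε ≠ 0`, so that contact axes are
nonzero). [cite: GST2013, §1.1] -/
theorem configEnergy_step (hS : IsUnit S) (hε : ε ≠ 0) (u : U) (z : Config N d X) :
    configEnergy (step G ε S u z) = configEnergy z := by
  unfold step Driven.step
  dsimp only
  split_ifs with h₁ h₂
  · rfl
  · set z' := freeFlight G (Alexander.freeExitTime G ε z).toReal z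
    obtain ⟨hlt, hcontact, hin⟩ := Alexander.mem_incomingPairs.1 h₂.some_mem
    have hω : G.sepVec (z' h₂.some.1).1 (z' h₂.some.2).1 ≠ 0 := by
      intro h0
      have h1 : ‖G.sepVec (z' h₂.some.1).1 (z' h₂.some.2).1‖ = ε := hcontact.2
      rw [h0, norm_zero] at h1
      exact hε h1.symm
    have hg : (z' h₂.some.1).2 - (z' h₂.some.2).2 ≠ 0 := by
      intro h0
      have h1 : ⟪G.sepVec (z' h₂.some.1).1 (z' h₂.some.2).1,
          (z' h₂.some.1).2 - (z' h₂.some.2).2⟫_ℝ < 0 := hin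
      rw [h0, inner_zero_right] at h1
      exact lt_irrefl _ h1
    rw [configEnergy_pair (ne_of_lt hlt) _ _ (hS _ _ _ hω hg)]
    exact configEnergy_freeFlight _ _ _
  · exact configEnergy_freeFlight _ _ _

/-- The kernel gas conserves the kinetic energy pathwise (unit-valued sampler, `ε ≠ 0`).
[cite: GST2013, §1.1] -/
theorem configEnergy_flow (hS : IsUnit S) (hε : ε ≠ 0) (us : ℕ → U) (z : Config N d X) (t : ℝ) :
    configEnergy (flow G ε S us z t) = configEnergy z := by
  have h : ∀ k, configEnergy (stateAfter G ε S us z k) = configEnergy z := by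
    intro k
    induction k with
    | zero => rfl
    | succ k ih =>
      rw [show stateAfter G ε S us z (k + 1) = step G ε S (us k) (stateAfter G ε S us z k) from rfl,
        configEnergy_step hS hε, ih]
  unfold flow Driven.flow
  rw [configEnergy_freeFlight, h]

/-! #### Special samplers: specular (deterministic hard spheres), Lambertian, `HS(p)` -/

variable (U) in
/-- The **specular sampler** (ignores the die): `n' = specularDir ω g`. With it the kernel gas is
the deterministic hard-sphere gas (`flow_specularSampler`). [cite: GST2013, (1.1.3)] -/
def specularSampler : DirectionSampler d U := fun ω g _ => specularDir ω g

/-- With the specular sampler the pair rule is the elastic collision `collidePair`.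
[cite: GST2013, (1.1.2)] -/
theorem pair_specularSampler (G : Geometry d X) (i j : Fin N) (z : Config N d X) (u : U) :
    pair G (specularSampler U) i j z u = collidePair G i j z :=
  redirectPair_specularDir G i j z

/-- **`k = δ_specular` IS THE DETERMINISTIC HARD-SPHERE GAS**: with the specular sampler the kernel
gas path is the library's collision-by-collision hard-sphere flow `Alexander.fwdFlow`, for every
dice sequence. [cite: CIP1994, §4.2 p. 65] -/
theorem flow_specularSampler (G : Geometry d X) (ε : ℝ) (us : ℕ → U) (z : Config N d X) (t : ℝ) :
    flow G ε (specularSampler U) us z t = Alexander.fwdFlow G ε z t :=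
  Driven.flow_eq_fwdFlow (fun i j z u => pair_specularSampler G i j z u) us z t

/-- The **Lambertian sampler** (dice space `ℝ^d`, to be thrown with the standard Gaussian):
`n' = normalize(ω̂ + ξ̂)`, the bisector of the axis and of an independent uniform direction `ξ̂`;
the axis argument only, the incoming direction is forgotten. In `d = 3` the law of `n'` is the
Knudsen cosine (Lambert) law `∝ ⟪n', ω̂⟫ dσ(n')` on the outgoing hemisphere (the bisector halves
the uniformly distributed angle); this is verbatim the redraw `ldir` of route
`SpecularLambertianSwap` and the re-scattering of `HS(p)` (card `angular-noise-ladder`).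
Junk (`0`) when `ξ̂ = -ω̂` or `ξ = 0`. [cite: CometsEtAl2008, §2.3] -/
def lambertSampler : DirectionSampler d (EuclideanSpace ℝ d) := fun ω _ ξ =>
  ‖‖ω‖⁻¹ • ω + ‖ξ‖⁻¹ • ξ‖⁻¹ • (‖ω‖⁻¹ • ω + ‖ξ‖⁻¹ • ξ)

/-- The Lambertian sampler returns unit vectors off its junk set. [folklore] -/
theorem norm_lambertSampler {ω g ξ : EuclideanSpace ℝ d} (h : ‖ω‖⁻¹ • ω + ‖ξ‖⁻¹ • ξ ≠ 0) :
    ‖lambertSampler ω g ξ‖ = 1 := by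
  rw [lambertSampler, norm_smul, norm_inv, norm_norm, inv_mul_cancel₀ (norm_ne_zero_iff.2 h)]

/-- **`HS(p)`: specular with probability `p`, else redraw by `S`** — the sampler on the dice space
`U × [0,1]` (to be thrown with `μ ⊗ Lebesgue`) reading `specularDir ω g` if the second die is
`≤ p` and `S ω g u` otherwise (card `angular-noise-ladder`: `p = 1` is the deterministic gas,
`p = 0` the fully re-scattered one). [folklore] -/
def withSpecular (p : ℝ) (S : DirectionSampler d U) : DirectionSampler d (U × I) :=
  fun ω g u => if (u.2 : ℝ) ≤ p then specularDir ω g else S ω g u.1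

/-- At `p = 1` the interpolation is specular whatever the dice. [folklore] -/
theorem withSpecular_one (S : DirectionSampler d U) (ω g : EuclideanSpace ℝ d) (u : U × I) :
    withSpecular 1 S ω g u = specularDir ω g := by
  simp [withSpecular, u.2.2.2]

/-- Below `p = 0` the interpolation never reads the specular branch off the null event
`u.2 = 0`: for `u.2 > 0`, `withSpecular 0 S ω g u = S ω g u.1`. [folklore] -/
theorem withSpecular_zero (S : DirectionSampler d U) (ω g : EuclideanSpace ℝ d) {u : U × I}
    (hu : 0 < (u.2 : ℝ)) : withSpecular 0 S ω g u = S ω g u.1 := by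
  simp [withSpecular, not_le.2 hu]

end KernelGas

/-! ### Collision kernels as Markov kernels; the process `HS(k)` -/

section Kernel

variable {d : Type*} [Fintype d]

/-- A **collision kernel** `k(dn' | ω̂, ĝ)`: a Mathlib Markov kernel from (contact axis, incoming
relative direction) to outgoing directions on `ℝ^d` (meant: fed with unit vectors, valued in unit
vectors of the outgoing hemisphere, `IsOutgoingSupported`) — Feres' Markov / random-reflection
operator `P` of a random billiard, here at a pair contact. [cite: CookFeres2012, §1.3] -/
abbrev CollisionKernel (d : Type*) [Fintype d] : Type _ :=
  Kernel (EuclideanSpace ℝ d × EuclideanSpace ℝ d) (EuclideanSpace ℝ d)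

variable (κ : CollisionKernel d) [IsMarkovKernel κ]

/-- Every collision kernel is realised by a jointly measurable `[0,1]`-sampler (Kallenberg 2021,
Lemma 4.22; Mathlib's `Kernel.exists_measurable_map_eq_unitInterval`). [folklore] -/
theorem exists_unitSampler :
    ∃ f : EuclideanSpace ℝ d × EuclideanSpace ℝ d → I → EuclideanSpace ℝ d,
      Measurable (uncurry f) ∧ ∀ a, volume.map (f a) = κ a :=
  Kernel.exists_measurable_map_eq_unitInterval κ

/-- A chosen `[0,1]`-sampler of the kernel on raw inputs. [folklore] -/
def rawSampler : EuclideanSpace ℝ d × EuclideanSpace ℝ d → I → EuclideanSpace ℝ d :=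
  Classical.choose (exists_unitSampler κ)

/-- The raw sampler is jointly measurable. [folklore] -/
theorem measurable_rawSampler : Measurable (uncurry (rawSampler κ)) :=
  (Classical.choose_spec (exists_unitSampler κ)).1

/-- The raw sampler realises the kernel: `Leb ∘ (rawSampler κ a)⁻¹ = κ a`. [folklore] -/
theorem map_rawSampler (a : EuclideanSpace ℝ d × EuclideanSpace ℝ d) :
    volume.map (rawSampler κ a) = κ a :=
  (Classical.choose_spec (exists_unitSampler κ)).2 a

/-- **The direction sampler of a collision kernel**: normalise the contact axis and the incoming
relative velocity and sample `κ (ω̂, ĝ)` with a uniform die `u ∈ [0,1]` (the kernel sees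
directions only; `|g|` is restored by the pair rule). [folklore] -/
def kernelSampler : DirectionSampler d I :=
  fun ω g u => rawSampler κ (‖ω‖⁻¹ • ω, ‖g‖⁻¹ • g) u

/-- The kernel sampler realises `κ` at the normalised inputs. [folklore] -/
theorem map_kernelSampler (ω g : EuclideanSpace ℝ d) :
    volume.map (kernelSampler κ ω g) = κ (‖ω‖⁻¹ • ω, ‖g‖⁻¹ • g) :=
  map_rawSampler κ _

/-- Normalisation `x ↦ |x|⁻¹ x` is measurable. [folklore] -/
theorem measurable_normalize :
    Measurable fun x : EuclideanSpace ℝ d => ‖x‖⁻¹ • x :=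
  measurable_norm.inv.smul measurable_id

/-- The kernel sampler is jointly measurable in (axis, relative velocity, die). [folklore] -/
theorem measurable_kernelSampler :
    Measurable fun q : (EuclideanSpace ℝ d × EuclideanSpace ℝ d) × I =>
      kernelSampler κ q.1.1 q.1.2 q.2 := by
  have h : Measurable fun q : (EuclideanSpace ℝ d × EuclideanSpace ℝ d) × I =>
      ((‖q.1.1‖⁻¹ • q.1.1, ‖q.1.2‖⁻¹ • q.1.2), q.2) :=
    ((measurable_normalize.comp measurable_fst.fst).prodMk
      (measurable_normalize.comp measurable_fst.snd)).prodMk measurable_snd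
  exact (measurable_rawSampler κ).comp h

variable {X : Type*} {N : ℕ}

/-- The path of the kernel gas `HS(k)` driven by uniform dice `us : ℕ → [0,1]`:
`KernelGas.flow` with the kernel's sampler. [folklore] -/
def kernelGasFlow (G : Geometry d X) (ε : ℝ) (us : ℕ → I) (z : Config N d X) (t : ℝ) :
    Config N d X :=
  KernelGas.flow G ε (kernelSampler κ) us z t

/-- The law of the dice of `HS(k)`: i.i.d. uniform on `[0,1]`, one per collision. [folklore] -/
def unitDice : Measure (ℕ → I) :=
  KernelGas.dice (volume : Measure I)

/-- The dice law is a probability measure. [folklore] -/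
instance : IsProbabilityMeasure unitDice := by
  unfold unitDice; infer_instance

/-- **The stochastic-collision hard-sphere process `HS(k)`** of `N` spheres of diameter `ε` in the
geometry `G` with collision kernel `κ`: its time-`t` map on the canonical sample space
`Ω = (initial configuration) × (dice sequence)`, `(z, us) ↦ Λ_t(z; us)` — free flight in the
hard-sphere domain, and at each incoming binary contact the pair is redirected along a direction
drawn from `κ (ω̂, ĝ)` (realised by `kernelSampler κ` and the `k`-th die), conserving pair
momentum and energy. Under `P₀ ⊗ unitDice` this is the kernel gas started from the law `P₀`
(`kernelGasLawAt`); `κ = specularKernel` gives the deterministic hard-sphere gas in law, the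
normalised `fluxOut` (cosine law) the Lambertian gas. A piecewise-deterministic Markov process in
the sense of Davis 1984 (flow = free flight, active boundary = incoming contacts, jump kernel = the
pair redraw). [cite: Davis1984, §2] -/
def StochasticCollisionHardSphereProcess (G : Geometry d X) (ε : ℝ) (N : ℕ) (t : ℝ)
    (q : Config N d X × (ℕ → I)) : Config N d X :=
  kernelGasFlow κ G ε q.2 q.1 t

/-- Unfolding the process. [folklore] -/
@[simp]
theorem stochasticCollisionHardSphereProcess_apply (G : Geometry d X) (ε : ℝ) (N : ℕ) (t : ℝ)
    (z : Config N d X) (us : ℕ → I) :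
    StochasticCollisionHardSphereProcess κ G ε N t (z, us) =
      KernelGas.flow G ε (kernelSampler κ) us z t := rfl

variable [MeasurableSpace X]

/-- **The time-`t` law `kernelGasLawAt κ G ε N P₀ t`** of `HS(k)` started from `P₀`: the
push-forward of `P₀ ⊗ unitDice` by the time-`t` map (cf. `HardSphereFlow.lawAt` for the
deterministic gas; a genuine push-forward by `measurable_stochasticCollisionHardSphereProcess`).
[folklore] -/
def kernelGasLawAt (G : Geometry d X) (ε : ℝ) (N : ℕ) (P₀ : Measure (Config N d X)) (t : ℝ) :
    Measure (Config N d X) :=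
  (P₀.prod unitDice).map (StochasticCollisionHardSphereProcess κ G ε N t)

/-- The law of the collision sequence `(z_k, t_k)_k` of `HS(k)` started from `P₀`.
[cite: Davis1984, §2] -/
def kernelGasEventLaw (G : Geometry d X) (ε : ℝ) (N : ℕ) (P₀ : Measure (Config N d X)) :
    Measure (ℕ → Config N d X × ℝ≥0∞) :=
  KernelGas.eventLaw G ε (kernelSampler κ) (volume : Measure I) P₀

/-- The path-space law of `HS(k)` started from `P₀`. [folklore] -/
def kernelGasPathLaw (G : Geometry d X) (ε : ℝ) (N : ℕ) (P₀ : Measure (Config N d X)) :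
    Measure (ℝ → Config N d X) :=
  KernelGas.pathLaw G ε (kernelSampler κ) (volume : Measure I) P₀

/-- `kernelGasLawAt` through the generic `KernelGas.lawAt`. [folklore] -/
theorem kernelGasLawAt_eq (G : Geometry d X) (ε : ℝ) (N : ℕ) (P₀ : Measure (Config N d X))
    (t : ℝ) :
    kernelGasLawAt κ G ε N P₀ t = KernelGas.lawAt G ε (kernelSampler κ) (volume : Measure I) P₀ t :=
  rfl

end Kernel

/-! ### Flux measures on the sphere and the predicates on a collision kernel -/

section Flux

variable {d : Type*} [Fintype d]

variable (d) in
/-- The surface measure `σ` of the unit sphere `S^{d-1}`, as a measure on `ℝ^d` concentrated on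
the sphere (Mathlib's `Measure.toSphere` of Lebesgue measure, pushed forward along the inclusion;
total mass `d · |B₁|`). [folklore] -/
def unitSphereMeasure : Measure (EuclideanSpace ℝ d) :=
  ((volume : Measure (EuclideanSpace ℝ d)).toSphere).map (↑)

/-- The **incoming flux (Knudsen cosine) measure** at the unit axis `ω`:
`fluxIn ω (dg) = (-⟪g, ω⟫)₊ σ(dg)` — the cosine law on the incoming hemisphere `⟪g, ω⟫ < 0`, zero
on the outgoing one (Cook–Feres 2012 Thm. 1, "Knudsen probability distribution", unnormalised).
[cite: CookFeres2012, Thm. 1] -/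
def fluxIn (ω : EuclideanSpace ℝ d) : Measure (EuclideanSpace ℝ d) :=
  (unitSphereMeasure d).withDensity fun g => ENNReal.ofReal (-⟪g, ω⟫_ℝ)

/-- The **outgoing flux (Knudsen cosine) measure** at the unit axis `ω`:
`fluxOut ω (dn) = (⟪n, ω⟫)₊ σ(dn)`, the cosine (Lambert) law on the outgoing hemisphere,
unnormalised. [cite: CookFeres2012, Thm. 1] -/
def fluxOut (ω : EuclideanSpace ℝ d) : Measure (EuclideanSpace ℝ d) :=
  (unitSphereMeasure d).withDensity fun n => ENNReal.ofReal ⟪n, ω⟫_ℝ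

/-- The collision kernel at a fixed axis, as a kernel `ĝ ↦ k(· | ω, ĝ)` on directions.
[folklore] -/
def atAxis (κ : CollisionKernel d) (ω : EuclideanSpace ℝ d) :
    Kernel (EuclideanSpace ℝ d) (EuclideanSpace ℝ d) :=
  κ.comap (fun g => (ω, g)) measurable_prodMk_left

/-- Unfolding `atAxis`. [folklore] -/
@[simp]
theorem atAxis_apply (κ : CollisionKernel d) (ω g : EuclideanSpace ℝ d) :
    atAxis κ ω g = κ (ω, g) := rfl

/-- `atAxis` of a Markov kernel is Markov. [folklore] -/
instance (κ : CollisionKernel d) [IsMarkovKernel κ] (ω : EuclideanSpace ℝ d) :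
    IsMarkovKernel (atAxis κ ω) := by
  unfold atAxis; infer_instance

/-- The **pair flux** at the unit axis `ω`: the measure `fluxIn ω (dĝ) k(dn' | ω, ĝ)` on
(incoming direction, outgoing direction) pairs — the stationary two-step law of the collision
mechanism seen from the flux measure. [cite: CookFeres2012, §2.2] -/
def pairFlux (κ : CollisionKernel d) (ω : EuclideanSpace ℝ d) :
    Measure (EuclideanSpace ℝ d × EuclideanSpace ℝ d) :=
  fluxIn ω ⊗ₘ atAxis κ ω

/-- **Outgoing support**: fed with a unit axis and a unit incoming direction, the kernel returns
almost surely a unit vector of the OPEN outgoing hemisphere `⟪n', ω⟫ > 0` (so that the pair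
separates, `isOutgoing_redirectPair_iff`; Comets et al. 2008 §2.2: `γ̄` lives on the open
hemisphere `S_e`). [cite: CometsEtAl2008, §2.2] -/
def IsOutgoingSupported (κ : CollisionKernel d) : Prop :=
  ∀ ω g : EuclideanSpace ℝ d, ‖ω‖ = 1 → ‖g‖ = 1 → ⟪g, ω⟫_ℝ < 0 →
    ∀ᵐ n ∂κ (ω, g), ‖n‖ = 1 ∧ 0 < ⟪n, ω⟫_ℝ

/-- **Flux stationarity** (the Knudsen cosine law is invariant): at every unit axis the kernel
maps the incoming flux measure onto the outgoing one,
`∫ fluxIn ω (dĝ) k(· | ω, ĝ) = fluxOut ω` (Cook–Feres 2012 Thm. 1 / Prop. 8; Comets et al. 2008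
Thm. 2.4: for the cosine reflection law, uniform position ⊗ uniform direction is invariant for the
Knudsen stochastic billiard). Together with conservation of pair momentum and `|g|` this is what
makes Liouville ⊗ Maxwellians (and hard-core Gibbs laws) invariant for the kernel gas.
[cite: CookFeres2012, Prop. 8] -/
def IsFluxStationary (κ : CollisionKernel d) : Prop :=
  ∀ ω : EuclideanSpace ℝ d, ‖ω‖ = 1 → (pairFlux κ ω).snd = fluxOut ω

/-- **Flux reciprocity** (time-reversal symmetry / detailed balance of the collision mechanism):
at every unit axis the pair flux `fluxIn ω (dĝ) k(dn' | ω, ĝ)` is invariant under the reversal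
`(ĝ, n') ↦ (-n', -ĝ)` of a binary collision — the intrinsic form of `P* = J P J` for the Markov
operator of a random billiard derived from a time-reversible microstructure (Cook–Feres 2012
Prop. 3, with `J` = minus the specular identification of incoming and outgoing hemispheres;
Comets et al. 2008 Thm. 2.5: the Knudsen stochastic billiard is reversible up to the velocity
flip), i.e. detailed balance with respect to flux measure ⊗ Maxwellian. With the symmetry of `σ`
it implies `IsFluxStationary` for Markov kernels (marginals; not proved here).
[cite: CookFeres2012, Prop. 3] -/
def IsFluxReciprocal (κ : CollisionKernel d) : Prop :=
  ∀ ω : EuclideanSpace ℝ d, ‖ω‖ = 1 →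
    (pairFlux κ ω).map (fun p => (-p.2, -p.1)) = pairFlux κ ω

/-- **Isotropy** (frame independence): the kernel commutes with linear isometries of `ℝ^d`,
`k(R · | R ω, R g) = k(· | ω, g)` (automatic for kernels built from `⟪·, ω⟫`, `⟪·, g⟫` alone; a
quenched anisotropic microstructure would violate it). [folklore] -/
def IsIsotropic (κ : CollisionKernel d) : Prop :=
  ∀ (R : EuclideanSpace ℝ d ≃ₗᵢ[ℝ] EuclideanSpace ℝ d) (ω g : EuclideanSpace ℝ d),
    (κ (ω, g)).map R = κ (R ω, R g)

/-- The specular direction is jointly measurable in (axis, relative velocity). [folklore] -/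
theorem measurable_specularDir :
    Measurable fun q : EuclideanSpace ℝ d × EuclideanSpace ℝ d => specularDir q.1 q.2 := by
  unfold specularDir
  refine measurable_snd.norm.inv.smul (measurable_snd.sub ?_)
  exact (measurable_const.mul ((measurable_snd.inner measurable_fst).div
    (measurable_fst.norm.pow_const 2))).smul measurable_fst

/-- **`δ_specular`**: the deterministic kernel `k(· | ω, g) = δ_{specularDir ω g}` — the elastic
hard-sphere gas as a kernel gas. [cite: GST2013, (1.1.3)] -/
def specularKernel : CollisionKernel d :=
  Kernel.deterministic (fun q => specularDir q.1 q.2) measurable_specularDir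

/-- The specular kernel is Markov. [folklore] -/
instance : IsMarkovKernel (specularKernel (d := d)) := by
  unfold specularKernel; infer_instance

/-- Unfolding the specular kernel. [folklore] -/
theorem specularKernel_apply (ω g : EuclideanSpace ℝ d) :
    specularKernel (ω, g) = Measure.dirac (specularDir ω g) := by
  rw [specularKernel, Kernel.deterministic_apply]

end Flux

/-! ### Measurability of the driven recursion (any jointly measurable rule) and of `HS(k)` -/

namespace Driven

variable {d : Type*} [Fintype d] {X : Type*} {N : ℕ} {Ξ : Type*} [MeasurableSpace X]
  [MeasurableSpace Ξ] {G : Geometry d X} {ε : ℝ}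
  {R : Fin N → Fin N → Config N d X → Ξ → Config N d X}

/-- A noise-driven pair rule is **jointly measurable** if each `(z, ξ) ↦ R i j z ξ` is.
[folklore] -/
def MeasurableRule (R : Fin N → Fin N → Config N d X → Ξ → Config N d X) : Prop :=
  ∀ i j, Measurable fun q : Config N d X × Ξ => R i j q.1 q.2

open Classical in
/-- The choice made by the driven step as a function of the SET of incoming pairs (as
`Alexander.stepMap` for the deterministic step). [folklore] -/
def stepMap (R : Fin N → Fin N → Config N d X → Ξ → Config N d X) (S : Set (Fin N × Fin N))
    (w : Config N d X) (ξ : Ξ) : Config N d X :=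
  if h : S.Nonempty then R h.some.1 h.some.2 w ξ else w

omit [MeasurableSpace X] [MeasurableSpace Ξ] in
/-- The driven step through `stepMap`. [folklore] -/
theorem step_eq (ξ : Ξ) (z : Config N d X) :
    step G ε R ξ z = if Alexander.freeExitTime G ε z = ∞ then z else
      stepMap R (Alexander.incomingPairs G ε
          (freeFlight G (Alexander.freeExitTime G ε z).toReal z))
        (freeFlight G (Alexander.freeExitTime G ε z).toReal z) ξ := by
  unfold step stepMap
  congr

omit [Fintype d] in
/-- For a fixed set of pairs, `stepMap R S` is jointly measurable. [folklore] -/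
theorem measurable_stepMap (hR : MeasurableRule R) (S : Set (Fin N × Fin N)) :
    Measurable fun q : Config N d X × Ξ => stepMap R S q.1 q.2 := by
  unfold stepMap
  split_ifs with h
  · exact hR _ _
  · exact measurable_fst

/-- `a ↦ stepMap R (incomingPairs (w a)) (w a) (ξ a)` is measurable for measurable `w`, `ξ`: the
set of incoming pairs takes finitely many values on measurable level sets. [folklore] -/
theorem measurable_stepMap_incomingPairs {α : Type*} [MeasurableSpace α] (hGm : G.IsMeasurable)
    (hR : MeasurableRule R) {w : α → Config N d X} (hw : Measurable w) {ξ : α → Ξ}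
    (hξ : Measurable ξ) :
    Measurable fun a => stepMap R (Alexander.incomingPairs G ε (w a)) (w a) (ξ a) := by
  letI : MeasurableSpace (Set (Fin N × Fin N)) := ⊤
  haveI : MeasurableSingletonClass (Set (Fin N × Fin N)) := ⟨fun _ => trivial⟩
  have hF : Measurable fun p : Set (Fin N × Fin N) × (Config N d X × Ξ) =>
      stepMap R p.1 p.2.1 p.2.2 :=
    measurable_from_prod_countable_right fun S => measurable_stepMap hR S
  have hS : Measurable fun a => Alexander.incomingPairs G ε (w a) := by
    refine measurable_to_countable' fun S => ?_
    have hset : (fun a => Alexander.incomingPairs G ε (w a)) ⁻¹' {S} =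
        ⋂ p : Fin N × Fin N, {a | p ∈ Alexander.incomingPairs G ε (w a) ↔ p ∈ S} := by
      ext a
      simp only [mem_preimage, mem_singleton_iff, mem_iInter, mem_setOf_eq, Set.ext_iff]
    rw [hset]
    refine MeasurableSet.iInter fun p => measurableSet_setOf.2 ?_
    exact (measurableSet_setOf.1
      ((Alexander.measurableSet_mem_incomingPairs hGm p).preimage hw)).iff measurable_const
  exact hF.comp (hS.prodMk (hw.prodMk hξ))

section Step

variable [TopologicalSpace X]

/-- **The driven step is jointly measurable** in (datum, noise) for a regular measurable geometry
and a jointly measurable rule. [folklore] -/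
theorem measurable_step (hG : G.IsHardSphereRegular ε) (hGm : G.IsMeasurable)
    (hR : MeasurableRule R) : Measurable fun q : Config N d X × Ξ => step G ε R q.2 q.1 := by
  have hτ : Measurable fun q : Config N d X × Ξ => Alexander.freeExitTime G ε q.1 :=
    (Alexander.measurable_freeExitTime hG hGm).comp measurable_fst
  have hz' : Measurable fun q : Config N d X × Ξ =>
      freeFlight G (Alexander.freeExitTime G ε q.1).toReal q.1 :=
    hGm.measurable_freeFlight₂.comp (hτ.ennreal_toReal.prodMk measurable_fst)
  have h : (fun q : Config N d X × Ξ => step G ε R q.2 q.1) = fun q =>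
      if Alexander.freeExitTime G ε q.1 = ∞ then q.1 else
        stepMap R (Alexander.incomingPairs G ε
            (freeFlight G (Alexander.freeExitTime G ε q.1).toReal q.1))
          (freeFlight G (Alexander.freeExitTime G ε q.1).toReal q.1) q.2 :=
    funext fun q => step_eq q.2 q.1
  rw [h]
  exact Measurable.ite (hτ (measurableSet_singleton ∞)) measurable_fst
    (measurable_stepMap_incomingPairs hGm hR hz' measurable_snd)

/-- The post-collisional states are jointly measurable in (datum, noise sequence). [folklore] -/
theorem measurable_stateAfter (hG : G.IsHardSphereRegular ε) (hGm : G.IsMeasurable)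
    (hR : MeasurableRule R) (k : ℕ) :
    Measurable fun q : Config N d X × (ℕ → Ξ) => stateAfter G ε R q.2 q.1 k := by
  induction k with
  | zero => exact measurable_fst
  | succ k ih =>
    have h2 : Measurable fun q : Config N d X × (ℕ → Ξ) => (stateAfter G ε R q.2 q.1 k, q.2 k) :=
      ih.prodMk ((measurable_pi_apply k).comp measurable_snd)
    have h3 := (measurable_step hG hGm hR).comp h2
    simp only [Function.comp_def] at h3
    simpa only [stateAfter_succ] using h3

/-- The collision instants are jointly measurable in (datum, noise sequence). [folklore] -/
theorem measurable_instant (hG : G.IsHardSphereRegular ε) (hGm : G.IsMeasurable)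
    (hR : MeasurableRule R) (k : ℕ) :
    Measurable fun q : Config N d X × (ℕ → Ξ) => instant G ε R q.2 q.1 k := by
  induction k with
  | zero => simp only [instant_zero, measurable_const]
  | succ k ih =>
    simp only [instant_succ]
    exact ih.add ((Alexander.measurable_freeExitTime hG hGm).comp (measurable_stateAfter hG hGm hR k))

/-- The number of collisions in `[0, t]` is jointly measurable in (datum, noise sequence).
[folklore] -/
theorem measurable_count (hG : G.IsHardSphereRegular ε) (hGm : G.IsMeasurable)
    (hR : MeasurableRule R) (t : ℝ) :
    Measurable fun q : Config N d X × (ℕ → Ξ) => count G ε R q.2 q.1 t := by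
  refine measurable_to_countable' fun k => ?_
  have hA : ∀ m, MeasurableSet
      {q : Config N d X × (ℕ → Ξ) | instant G ε R q.2 q.1 m ≤ ENNReal.ofReal t} :=
    fun m => measurableSet_le (measurable_instant hG hGm hR m) measurable_const
  have hset : (fun q : Config N d X × (ℕ → Ξ) => count G ε R q.2 q.1 t) ⁻¹' {k} =
      {q | (instant G ε R q.2 q.1 k ≤ ENNReal.ofReal t ∧
        ¬instant G ε R q.2 q.1 (k + 1) ≤ ENNReal.ofReal t) ∨
        (k = 0 ∧ ∀ m, instant G ε R q.2 q.1 m ≤ ENNReal.ofReal t)} := by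
    ext q
    simp only [mem_preimage, mem_singleton_iff, mem_setOf_eq]
    exact Nat.sSup_eq_iff_of_lowerSet (S := {m | instant G ε R q.2 q.1 m ≤ ENNReal.ofReal t})
      (by simp) (fun m n hmn hn => (monotone_instant q.2 q.1 hmn).trans hn) k
  rw [hset]
  refine measurableSet_setOf.2 ((((measurableSet_setOf.1 (hA k)).and
    (measurableSet_setOf.1 (hA (k + 1))).not)).or (measurable_const.and
      (Measurable.forall fun m => measurableSet_setOf.1 (hA m))))

/-- **The time-`t` map of the driven flow is jointly measurable** in (datum, noise sequence), for
a regular measurable geometry and a jointly measurable rule (the measurability clause (a) of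
route `SpecularLambertianSwap`'s `LambertianWellPosed`, for every driven gas). [folklore] -/
theorem measurable_flow (hG : G.IsHardSphereRegular ε) (hGm : G.IsMeasurable)
    (hR : MeasurableRule R) (t : ℝ) :
    Measurable fun q : Config N d X × (ℕ → Ξ) => flow G ε R q.2 q.1 t := by
  have hF : Measurable fun p : ℕ × (Config N d X × (ℕ → Ξ)) =>
      freeFlight G (t - (instant G ε R p.2.2 p.2.1 p.1).toReal)
        (stateAfter G ε R p.2.2 p.2.1 p.1) :=
    measurable_from_prod_countable_right fun k => hGm.measurable_freeFlight₂.comp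
      ((measurable_const.sub (measurable_instant hG hGm hR k).ennreal_toReal).prodMk
        (measurable_stateAfter hG hGm hR k))
  unfold flow
  exact hF.comp ((measurable_count hG hGm hR t).prodMk measurable_id)

end Step

end Driven

namespace KernelGas

variable {d : Type*} [Fintype d] {X : Type*} {N : ℕ} {U : Type*} [MeasurableSpace X]
  [MeasurableSpace U] {G : Geometry d X} {ε : ℝ} {S : DirectionSampler d U}

/-- A direction sampler is **jointly measurable** if `((ω, g), u) ↦ S ω g u` is. [folklore] -/
def MeasurableSampler (S : DirectionSampler d U) : Prop :=
  Measurable fun q : (EuclideanSpace ℝ d × EuclideanSpace ℝ d) × U => S q.1.1 q.1.2 q.2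

/-- The kernel-gas rule of a measurable sampler in a measurable geometry is a jointly measurable
rule. [folklore] -/
theorem measurableRule_pair (hGm : G.IsMeasurable) (hS : MeasurableSampler S) :
    Driven.MeasurableRule (pair G S : Fin N → Fin N → Config N d X → U → Config N d X) := by
  intro i j
  have hn : Measurable fun q : Config N d X × U =>
      S (G.sepVec (q.1 i).1 (q.1 j).1) ((q.1 i).2 - (q.1 j).2) q.2 :=
    hS.comp ((((hGm.measurable_sepVec_config i j).comp measurable_fst).prodMk
      (((Geometry.IsMeasurable.measurable_vel i).sub
        (Geometry.IsMeasurable.measurable_vel j)).comp measurable_fst)).prodMk measurable_snd)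
  exact (measurable_redirectPair i j).comp (measurable_fst.prodMk hn)

/-- The specular sampler is measurable. [folklore] -/
theorem measurableSampler_specularSampler : MeasurableSampler (specularSampler (d := d) U) :=
  measurable_specularDir.comp measurable_fst

/-- The Lambertian sampler is measurable. [folklore] -/
theorem measurableSampler_lambertSampler : MeasurableSampler (lambertSampler (d := d)) := by
  unfold MeasurableSampler lambertSampler
  exact measurable_normalize.comp ((measurable_normalize.comp measurable_fst.fst).add
    (measurable_normalize.comp measurable_snd))

/-- `HS(p)` of a measurable sampler is measurable. [folklore] -/
theorem measurableSampler_withSpecular (p : ℝ) (hS : MeasurableSampler S) :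
    MeasurableSampler (withSpecular p S) := by
  unfold MeasurableSampler withSpecular
  refine Measurable.ite ?_ (measurable_specularDir.comp measurable_fst)
    (hS.comp (measurable_fst.prodMk measurable_snd.fst))
  exact measurableSet_le (measurable_subtype_coe.comp measurable_snd.snd) measurable_const

variable [TopologicalSpace X]

/-- Post-collisional states of the kernel gas are jointly measurable in (datum, dice).
[folklore] -/
theorem measurable_stateAfter (hG : G.IsHardSphereRegular ε) (hGm : G.IsMeasurable)
    (hS : MeasurableSampler S) (k : ℕ) :
    Measurable fun q : Config N d X × (ℕ → U) => stateAfter G ε S q.2 q.1 k :=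
  Driven.measurable_stateAfter hG hGm (measurableRule_pair hGm hS) k

/-- Collision instants of the kernel gas are jointly measurable in (datum, dice). [folklore] -/
theorem measurable_instant (hG : G.IsHardSphereRegular ε) (hGm : G.IsMeasurable)
    (hS : MeasurableSampler S) (k : ℕ) :
    Measurable fun q : Config N d X × (ℕ → U) => instant G ε S q.2 q.1 k :=
  Driven.measurable_instant hG hGm (measurableRule_pair hGm hS) k

/-- **The time-`t` map of the kernel gas is jointly measurable** in (datum, dice) (regular
measurable geometry, measurable sampler). [folklore] -/
theorem measurable_flow (hG : G.IsHardSphereRegular ε) (hGm : G.IsMeasurable)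
    (hS : MeasurableSampler S) (t : ℝ) :
    Measurable fun q : Config N d X × (ℕ → U) => flow G ε S q.2 q.1 t :=
  Driven.measurable_flow hG hGm (measurableRule_pair hGm hS) t

/-- Hence the time-`t` law of a probability initial law is a probability measure. [folklore] -/
theorem isProbabilityMeasure_lawAt (hG : G.IsHardSphereRegular ε) (hGm : G.IsMeasurable)
    (hS : MeasurableSampler S) (μ : Measure U) [IsProbabilityMeasure μ]
    (P₀ : Measure (Config N d X)) [IsProbabilityMeasure P₀] (t : ℝ) :
    IsProbabilityMeasure (lawAt G ε S μ P₀ t) :=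
  Measure.isProbabilityMeasure_map (measurable_flow hG hGm hS t).aemeasurable

/-- The collision-sequence map is measurable (product σ-algebra on sequences). [folklore] -/
theorem measurable_events (hG : G.IsHardSphereRegular ε) (hGm : G.IsMeasurable)
    (hS : MeasurableSampler S) :
    Measurable fun (q : Config N d X × (ℕ → U)) (k : ℕ) =>
      (stateAfter G ε S q.2 q.1 k, instant G ε S q.2 q.1 k) :=
  measurable_pi_lambda _ fun k =>
    (measurable_stateAfter hG hGm hS k).prodMk (measurable_instant hG hGm hS k)

/-- The path map is measurable (product σ-algebra on paths). [folklore] -/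
theorem measurable_path (hG : G.IsHardSphereRegular ε) (hGm : G.IsMeasurable)
    (hS : MeasurableSampler S) :
    Measurable fun (q : Config N d X × (ℕ → U)) (t : ℝ) => flow G ε S q.2 q.1 t :=
  measurable_pi_lambda _ fun t => measurable_flow hG hGm hS t

end KernelGas

section KernelMeasurable

variable {d : Type*} [Fintype d] (κ : CollisionKernel d) [IsMarkovKernel κ] {X : Type*} {N : ℕ}
  [MeasurableSpace X] [TopologicalSpace X] {G : Geometry d X} {ε : ℝ}

/-- The kernel sampler is a measurable sampler. [folklore] -/
theorem measurableSampler_kernelSampler : KernelGas.MeasurableSampler (kernelSampler κ) :=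
  measurable_kernelSampler κ

/-- **`HS(k)` is a measurable process**: each time-`t` map `(z, us) ↦ Λ_t(z; us)` is measurable
on `Config × [0,1]^ℕ` (regular measurable geometry: `ℝ^d`, or `𝕋^d` with `ε < 1/2`), so
`kernelGasLawAt` is a genuine push-forward. [folklore] -/
theorem measurable_stochasticCollisionHardSphereProcess (hG : G.IsHardSphereRegular ε)
    (hGm : G.IsMeasurable) (N : ℕ) (t : ℝ) :
    Measurable (StochasticCollisionHardSphereProcess κ G ε N t) :=
  KernelGas.measurable_flow hG hGm (measurable_kernelSampler κ) t

/-- `HS(k)` on the flat torus (`ε < 1/2`) is a measurable process. [folklore] -/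
theorem measurable_stochasticCollisionHardSphereProcess_torus {ε : ℝ} (hε : ε < 2⁻¹) (N : ℕ)
    (t : ℝ) :
    Measurable (StochasticCollisionHardSphereProcess κ (Torus.geometry d) ε N t) :=
  measurable_stochasticCollisionHardSphereProcess κ (Torus.isHardSphereRegular_geometry hε)
    Torus.isMeasurable_geometry N t

/-- `HS(k)` in `ℝ^d` is a measurable process. [folklore] -/
theorem measurable_stochasticCollisionHardSphereProcess_euclidean (ε : ℝ) (N : ℕ) (t : ℝ) :
    Measurable (StochasticCollisionHardSphereProcess κ (Euclidean.geometry d) ε N t) :=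
  measurable_stochasticCollisionHardSphereProcess κ (Euclidean.isHardSphereRegular_geometry ε)
    Euclidean.isMeasurable_geometry N t

/-- The time-`t` law of `HS(k)` started from a probability law is a probability measure (regular
measurable geometry). [folklore] -/
theorem isProbabilityMeasure_kernelGasLawAt (hG : G.IsHardSphereRegular ε) (hGm : G.IsMeasurable)
    (N : ℕ) (P₀ : Measure (Config N d X)) [IsProbabilityMeasure P₀] (t : ℝ) :
    IsProbabilityMeasure (kernelGasLawAt κ G ε N P₀ t) :=
  Measure.isProbabilityMeasure_map
    (measurable_stochasticCollisionHardSphereProcess κ hG hGm N t).aemeasurable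

end KernelMeasurable

/-! ### Sanity: the specular kernel; densities on the sphere; Lambertian, uniform and `HS(p)`
kernels -/

section SpecialKernels

variable {d : Type*} [Fintype d]

/-- The specular sampler is unit-valued on collisions. [folklore] -/
theorem KernelGas.isUnit_specularSampler (U : Type*) :
    KernelGas.IsUnit (KernelGas.specularSampler (d := d) U) :=
  fun ω _ _ _ hg => norm_specularDir ω hg

/-- The specular kernel is supported in the outgoing hemisphere: the elastic law turns an
incoming pair into an outgoing one (`isOutgoing_collidePair_iff` at the kernel level).
[cite: GST2013, (1.1.3)] -/
theorem isOutgoingSupported_specularKernel : IsOutgoingSupported (specularKernel (d := d)) := by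
  intro ω g hω hg hin
  have hω0 : ω ≠ 0 := fun h => by simp [h] at hω
  have hg0 : g ≠ 0 := fun h => by simp [h] at hg
  rw [specularKernel_apply, ae_dirac_eq, Filter.eventually_pure]
  refine ⟨norm_specularDir ω hg0, ?_⟩
  rw [real_inner_comm, inner_specularDir ω g hω0, hg, div_one, neg_pos, real_inner_comm]
  exact hin

/-- The surface measure is finite. [folklore] -/
instance : IsFiniteMeasure (unitSphereMeasure d) := by
  unfold unitSphereMeasure; infer_instance

/-- The surface measure does not charge the complement of the unit sphere. [folklore] -/
theorem unitSphereMeasure_compl_sphere :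
    unitSphereMeasure d (Metric.sphere (0 : EuclideanSpace ℝ d) 1)ᶜ = 0 := by
  rw [unitSphereMeasure, Measure.map_apply measurable_subtype_coe
    Metric.isClosed_sphere.measurableSet.compl]
  have : ((↑) : Metric.sphere (0 : EuclideanSpace ℝ d) 1 → EuclideanSpace ℝ d) ⁻¹'
      (Metric.sphere (0 : EuclideanSpace ℝ d) 1)ᶜ = ∅ := by
    ext x
    simp
  rw [this, measure_empty]

/-- `σ`-almost every point is a unit vector. [folklore] -/
theorem ae_norm_eq_one_unitSphereMeasure : ∀ᵐ x ∂unitSphereMeasure d, ‖x‖ = 1 := by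
  have h : ∀ᵐ x ∂unitSphereMeasure d, x ∈ Metric.sphere (0 : EuclideanSpace ℝ d) 1 := by
    rw [ae_iff]
    exact unitSphereMeasure_compl_sphere
  exact h.mono fun x hx => by simpa using hx

/-- The surface measure charges every open set meeting the sphere. [folklore] -/
theorem unitSphereMeasure_pos_of_isOpen {s : Set (EuclideanSpace ℝ d)} (hs : IsOpen s)
    (hne : (s ∩ Metric.sphere 0 1).Nonempty) : 0 < unitSphereMeasure d s := by
  rw [unitSphereMeasure, Measure.map_apply measurable_subtype_coe hs.measurableSet]
  refine (hs.preimage continuous_subtype_val).measure_pos _ ?_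
  obtain ⟨x, hxs, hx⟩ := hne
  exact ⟨⟨x, hx⟩, hxs⟩

/-- The outgoing flux measure has finite mass `≤ |ω| σ(S^{d-1})`. [folklore] -/
theorem fluxOut_apply_univ_le (ω : EuclideanSpace ℝ d) :
    fluxOut ω univ ≤ ENNReal.ofReal ‖ω‖ * unitSphereMeasure d univ := by
  rw [fluxOut, withDensity_apply _ MeasurableSet.univ, Measure.restrict_univ]
  calc ∫⁻ n, ENNReal.ofReal ⟪n, ω⟫_ℝ ∂unitSphereMeasure d
      ≤ ∫⁻ _, ENNReal.ofReal ‖ω‖ ∂unitSphereMeasure d :=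
        lintegral_mono_ae (ae_norm_eq_one_unitSphereMeasure.mono fun n hn =>
          ENNReal.ofReal_le_ofReal ((real_inner_le_norm n ω).trans (by rw [hn, one_mul])))
    _ = ENNReal.ofReal ‖ω‖ * unitSphereMeasure d univ := lintegral_const _

/-- The outgoing flux measure is finite. [folklore] -/
theorem fluxOut_apply_univ_ne_top (ω : EuclideanSpace ℝ d) : fluxOut ω univ ≠ ∞ :=
  ne_top_of_le_ne_top (ENNReal.mul_ne_top ENNReal.ofReal_ne_top (measure_ne_top _ _))
    (fluxOut_apply_univ_le ω)

/-- The outgoing flux measure at a unit axis is nonzero (the polar cap `⟪n, ω⟫ > 1/2` is open,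
meets the sphere at `ω`, and carries density `≥ 1/2`). [folklore] -/
theorem fluxOut_apply_univ_ne_zero {ω : EuclideanSpace ℝ d} (hω : ‖ω‖ = 1) :
    fluxOut ω univ ≠ 0 := by
  have hcap : 0 < unitSphereMeasure d {n | 2⁻¹ < ⟪n, ω⟫_ℝ} := by
    refine unitSphereMeasure_pos_of_isOpen
      (isOpen_lt continuous_const (continuous_id.inner continuous_const)) ⟨ω, ?_, ?_⟩
    · show (2⁻¹ : ℝ) < ⟪ω, ω⟫_ℝ
      rw [real_inner_self_eq_norm_sq, hω]
      norm_num
    · simp [hω]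
  have hmeas : MeasurableSet {n : EuclideanSpace ℝ d | 2⁻¹ < ⟪n, ω⟫_ℝ} :=
    measurableSet_lt measurable_const (measurable_id.inner measurable_const)
  rw [fluxOut, withDensity_apply _ MeasurableSet.univ, Measure.restrict_univ]
  intro h0
  have hle : ENNReal.ofReal 2⁻¹ * unitSphereMeasure d {n | 2⁻¹ < ⟪n, ω⟫_ℝ} ≤
      ∫⁻ n, ENNReal.ofReal ⟪n, ω⟫_ℝ ∂unitSphereMeasure d := by
    rw [← lintegral_indicator_const hmeas]
    refine lintegral_mono fun n => ?_
    by_cases hn : n ∈ {n : EuclideanSpace ℝ d | 2⁻¹ < ⟪n, ω⟫_ℝ}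
    · rw [Set.indicator_of_mem hn]
      exact ENNReal.ofReal_le_ofReal (le_of_lt hn)
    · rw [Set.indicator_of_notMem hn]
      exact zero_le
  rw [h0] at hle
  exact (ENNReal.mul_pos (ENNReal.ofReal_pos.2 (by norm_num : (0 : ℝ) < 2⁻¹)).ne' hcap.ne').ne'
    (le_antisymm hle zero_le)

open Classical in
/-- The law on the sphere with density `F ω` at the axis `ω`, normalised to a probability
measure (Dirac fallback at the junk axes where the mass is `0` or `∞`, e.g. `ω = 0`): the common
shape of the Lambertian (cosine) and of the uniform outgoing laws. [folklore] -/
def axisDensityLaw (F : EuclideanSpace ℝ d → EuclideanSpace ℝ d → ℝ≥0∞) (ω : EuclideanSpace ℝ d) :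
    Measure (EuclideanSpace ℝ d) :=
  if ((unitSphereMeasure d).withDensity (F ω)) univ ≠ 0 ∧
      ((unitSphereMeasure d).withDensity (F ω)) univ ≠ ∞ then
    (((unitSphereMeasure d).withDensity (F ω)) univ)⁻¹ • (unitSphereMeasure d).withDensity (F ω)
  else Measure.dirac ω

/-- `axisDensityLaw F ω` is a probability measure (by construction). [folklore] -/
instance (F : EuclideanSpace ℝ d → EuclideanSpace ℝ d → ℝ≥0∞) (ω : EuclideanSpace ℝ d) :
    IsProbabilityMeasure (axisDensityLaw F ω) := by
  unfold axisDensityLaw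
  split_ifs with h
  · exact ⟨by rw [Measure.smul_apply, smul_eq_mul, ENNReal.inv_mul_cancel h.1 h.2]⟩
  · infer_instance

/-- For a jointly measurable density, `ω ↦ σ.withDensity (F ω) s` is measurable. [folklore] -/
theorem measurable_withDensity_apply {F : EuclideanSpace ℝ d → EuclideanSpace ℝ d → ℝ≥0∞}
    (hF : Measurable (uncurry F)) {s : Set (EuclideanSpace ℝ d)} (hs : MeasurableSet s) :
    Measurable fun ω => (unitSphereMeasure d).withDensity (F ω) s := by
  simp_rw [withDensity_apply _ hs]
  exact hF.lintegral_prod_right' (ν := (unitSphereMeasure d).restrict s)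

/-- For a jointly measurable density, `axisDensityLaw F` is a measurable measure-valued map (so
that it defines a kernel). [folklore] -/
theorem measurable_axisDensityLaw {F : EuclideanSpace ℝ d → EuclideanSpace ℝ d → ℝ≥0∞}
    (hF : Measurable (uncurry F)) : Measurable (axisDensityLaw F) := by
  classical
  refine Measure.measurable_of_measurable_coe _ fun s hs => ?_
  have h : (fun ω => axisDensityLaw F ω s) = fun ω =>
      if ((unitSphereMeasure d).withDensity (F ω)) univ ≠ 0 ∧
          ((unitSphereMeasure d).withDensity (F ω)) univ ≠ ∞ then
        (((unitSphereMeasure d).withDensity (F ω)) univ)⁻¹ *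
          (unitSphereMeasure d).withDensity (F ω) s
      else Measure.dirac ω s := by
    funext ω
    unfold axisDensityLaw
    split_ifs <;> rfl
  rw [h]
  have hu := measurable_withDensity_apply hF (MeasurableSet.univ : MeasurableSet (univ : Set _))
  refine Measurable.ite ?_ (hu.inv.mul (measurable_withDensity_apply hF hs))
    ((Measure.measurable_coe hs).comp Measure.measurable_dirac)
  exact (hu (measurableSet_singleton 0).compl).inter (hu (measurableSet_singleton ∞).compl)

/-- The kernel with density `F ω` on the sphere at each axis (incoming direction forgotten).
[folklore] -/
def axisDensityKernel (F : EuclideanSpace ℝ d → EuclideanSpace ℝ d → ℝ≥0∞)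
    (hF : Measurable (uncurry F)) : CollisionKernel d :=
  ⟨fun q => axisDensityLaw F q.1, (measurable_axisDensityLaw hF).comp measurable_fst⟩

/-- Unfolding `axisDensityKernel`. [folklore] -/
@[simp]
theorem axisDensityKernel_apply (F : EuclideanSpace ℝ d → EuclideanSpace ℝ d → ℝ≥0∞)
    (hF : Measurable (uncurry F)) (q : EuclideanSpace ℝ d × EuclideanSpace ℝ d) :
    axisDensityKernel F hF q = axisDensityLaw F q.1 := rfl

/-- `axisDensityKernel F` is Markov. [folklore] -/
instance (F : EuclideanSpace ℝ d → EuclideanSpace ℝ d → ℝ≥0∞) (hF : Measurable (uncurry F)) :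
    IsMarkovKernel (axisDensityKernel F hF) :=
  ⟨fun q => by rw [axisDensityKernel_apply]; infer_instance⟩

/-- The cosine density `(ω, n) ↦ (⟪n, ω⟫)₊` is jointly measurable. [folklore] -/
theorem measurable_cosineDensity :
    Measurable (uncurry fun ω n : EuclideanSpace ℝ d => ENNReal.ofReal ⟪n, ω⟫_ℝ) :=
  ENNReal.measurable_ofReal.comp (measurable_snd.inner measurable_fst)

/-- **The Lambertian (Knudsen cosine) kernel**: at axis `ω`, the outgoing direction has the cosine
law `∝ (⟪n', ω⟫)₊ σ(dn')` on the outgoing hemisphere, whatever the incoming direction — Knudsen's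
cosine reflection law `γ̄(u) = γ_d ⟪e, u⟫` / Lambert's law (Comets et al. 2008 §2.3; Feres–Yablonsky
2004), the re-scattering of `HS(p)` and of the Lambertian gas `HS(0)`. [cite: CometsEtAl2008, §2.3] -/
def lambertKernel : CollisionKernel d :=
  axisDensityKernel (fun ω n => ENNReal.ofReal ⟪n, ω⟫_ℝ) measurable_cosineDensity

/-- The Lambertian kernel is Markov. [folklore] -/
instance : IsMarkovKernel (lambertKernel (d := d)) := by
  unfold lambertKernel; infer_instance

/-- At a unit axis the Lambertian kernel IS the normalised outgoing flux (cosine) measure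
`fluxOut ω / fluxOut ω (S^{d-1})`. [cite: CometsEtAl2008, §2.3] -/
theorem lambertKernel_apply {ω : EuclideanSpace ℝ d} (hω : ‖ω‖ = 1) (g : EuclideanSpace ℝ d) :
    lambertKernel (ω, g) = (fluxOut ω univ)⁻¹ • fluxOut ω := by
  unfold lambertKernel
  rw [axisDensityKernel_apply]
  dsimp only
  unfold axisDensityLaw
  rw [if_pos]
  · rfl
  · exact ⟨fluxOut_apply_univ_ne_zero hω, fluxOut_apply_univ_ne_top ω⟩

/-- The hemisphere indicator `(ω, n) ↦ 𝟙{⟪n, ω⟫ > 0}` is jointly measurable. [folklore] -/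
theorem measurable_hemisphereIndicator :
    Measurable (uncurry fun ω n : EuclideanSpace ℝ d =>
      ({n | 0 < ⟪n, ω⟫_ℝ} : Set (EuclideanSpace ℝ d)).indicator (1 : EuclideanSpace ℝ d → ℝ≥0∞) n) := by
  have h : (uncurry fun ω n : EuclideanSpace ℝ d =>
      ({n | 0 < ⟪n, ω⟫_ℝ} : Set (EuclideanSpace ℝ d)).indicator (1 : EuclideanSpace ℝ d → ℝ≥0∞) n) =
      ({q | 0 < ⟪q.2, q.1⟫_ℝ} : Set (EuclideanSpace ℝ d × EuclideanSpace ℝ d)).indicator 1 := by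
    funext q
    simp only [uncurry, Set.indicator_apply, mem_setOf_eq, Pi.one_apply]
  rw [h]
  exact measurable_one.indicator (measurableSet_lt measurable_const (measurable_snd.inner measurable_fst))

/-- **The uniform outgoing kernel**: at axis `ω`, the outgoing direction is uniform (surface
measure) on the outgoing hemisphere `⟪n', ω⟫ > 0`, whatever the incoming direction (the
isotropic re-emission law; NOT flux-stationary — Comets et al. 2008 §2 contrast it with the
cosine law). [cite: CometsEtAl2008, §2.2] -/
def uniformOutKernel : CollisionKernel d :=
  axisDensityKernel (fun ω n => ({n | 0 < ⟪n, ω⟫_ℝ} : Set (EuclideanSpace ℝ d)).indicator 1 n)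
    measurable_hemisphereIndicator

/-- The uniform outgoing kernel is Markov. [folklore] -/
instance : IsMarkovKernel (uniformOutKernel (d := d)) := by
  unfold uniformOutKernel; infer_instance

/-- **The mixture of two collision kernels** with weights `p`, `1 - p` (`p ∈ [0,1]`):
`k_p = p k₁ + (1 - p) k₂` — at each collision use `k₁` with probability `p`, else `k₂`.
[folklore] -/
def mixKernel (p : I) (κ₁ κ₂ : CollisionKernel d) : CollisionKernel d where
  toFun a := ENNReal.ofReal p • κ₁ a + ENNReal.ofReal (1 - p) • κ₂ a
  measurable' := Measure.measurable_of_measurable_coe _ fun s hs => by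
    simp only [Measure.coe_add, Measure.coe_smul, Pi.add_apply, Pi.smul_apply, smul_eq_mul]
    exact ((κ₁.measurable_coe hs).const_mul _).add ((κ₂.measurable_coe hs).const_mul _)

/-- Unfolding the mixture. [folklore] -/
@[simp]
theorem mixKernel_apply (p : I) (κ₁ κ₂ : CollisionKernel d)
    (a : EuclideanSpace ℝ d × EuclideanSpace ℝ d) :
    mixKernel p κ₁ κ₂ a = ENNReal.ofReal p • κ₁ a + ENNReal.ofReal (1 - p) • κ₂ a := rfl

/-- A mixture of Markov kernels is Markov. [folklore] -/
instance (p : I) (κ₁ κ₂ : CollisionKernel d) [IsMarkovKernel κ₁] [IsMarkovKernel κ₂] :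
    IsMarkovKernel (mixKernel p κ₁ κ₂) := by
  refine ⟨fun a => ⟨?_⟩⟩
  rw [mixKernel_apply, Measure.add_apply, Measure.smul_apply, Measure.smul_apply, measure_univ,
    measure_univ, smul_eq_mul, smul_eq_mul, mul_one, mul_one,
    ← ENNReal.ofReal_add p.2.1 (sub_nonneg.2 p.2.2), add_sub_cancel, ENNReal.ofReal_one]

/-- **`HS(p)` as a collision kernel**: specular with probability `p`, Lambertian re-scattering with
probability `1 - p` (card `angular-noise-ladder`; `p = 1` the deterministic gas `δ_specular`,
`p = 0` the Lambertian gas). [folklore] -/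
def hsMixKernel (p : I) : CollisionKernel d :=
  mixKernel p specularKernel lambertKernel

/-- `HS(p)` is Markov. [folklore] -/
instance (p : I) : IsMarkovKernel (hsMixKernel (d := d) p) := by
  unfold hsMixKernel; infer_instance

/-- `HS(1) = δ_specular`. [folklore] -/
theorem hsMixKernel_one : hsMixKernel (d := d) 1 = specularKernel := by
  ext a s hs
  simp [hsMixKernel]

/-- `HS(0)` is the Lambertian kernel. [folklore] -/
theorem hsMixKernel_zero : hsMixKernel (d := d) 0 = lambertKernel := by
  ext a s hs
  simp [hsMixKernel]

end SpecialKernels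

end Literature.MathematicalPhysics.KineticTheory

end
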